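import Summits.Ventures.PercRepro.SixFourResidueFourPlaneLineClauses
import Summits.Ventures.PercRepro.SixFourResidueFourPlaneLineMargin

/-!
# PercRepro — C-025 at `(6,4)`: `TWTail` — the `g ≥ 101` clause of Lemma TW at `t = 4` (mine-2 g22; §21.18.7 TW-∞ /
§21.23; lead RULING (nu)(2))

`TWTail` (p5's `SixFourResidueFourPlaneLineClauses`): for `g ≥ 101`, `n ≥ 3`, `e ≤ 1`, `n + 4 ≤ g` — every class term
`w′(g,n,s) = T⁺(g, n+s) − (12/5)2^s − (48/5)n` is `≥ 0` (`e + 1 ≤ s ≤ p − 3`, `p = g − n`), `T⁺(g,p) ≥ 0`, and the larger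
class of a covering pair absorbs the pair charge `(12/5)2^{n+e}`.  Everything follows from the quantitative per-pair
margins `perPair4_margin` / `_IIa` / `_IIb` (`T⁺(g,q) ≥ a·2^q`, §21.23) and elementary numerics: `aI ≥ 0.4905` on
`3 ≤ c ≤ 10`, `aIIa, aIIb ≥ 22` on `c ≥ 11`, and `2^q` against linear terms.
-/

namespace PercRepro.SixFour

/-! ## `T⁺` from the margins -/

/-- If `C(m,2)·(base₄ + a·2^q) ≤ C(q,2)·L₄(m)` for every `2 ≤ m < q`, then `a·2^q ≤ T⁺(g,q)` (`q ≥ 3`). -/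
theorem Tplus_ge_of_forall {g q : ℕ} (hq : 3 ≤ q) (a : ℚ)
    (h : ∀ m, 2 ≤ m → m < q → (m.choose 2 : ℚ) * (base4 g q + a * 2 ^ q) ≤ (q.choose 2 : ℚ) * Lterm4 g q m) :
    a * 2 ^ q ≤ Tplus g q := by
  rw [Tplus_of_three_le hq]
  have hq2 : (0 : ℚ) < (q.choose 2 : ℚ) := by exact_mod_cast Nat.choose_pos (by omega : 2 ≤ q)
  have hinf : (base4 g q + a * 2 ^ q) / (q.choose 2 : ℚ) ≤
      (Finset.Icc 2 (q - 1)).inf' ⟨2, by rw [Finset.mem_Icc]; omega⟩ (fun m => Lterm4 g q m / (m.choose 2 : ℚ)) := by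
    apply Finset.le_inf'
    intro m hm
    rw [Finset.mem_Icc] at hm
    have hm2 : (0 : ℚ) < (m.choose 2 : ℚ) := by exact_mod_cast Nat.choose_pos (by omega : 2 ≤ m)
    rw [div_le_div_iff₀ hq2 hm2]
    have := h m hm.1 (by omega)
    linarith
  have := mul_le_mul_of_nonneg_left hinf hq2.le
  rw [mul_div_cancel₀ _ hq2.ne'] at this
  linarith

/-- The margin of the regime of `c = g − q`: `aI c` (`c ≤ 10`), `aIIa c` (`2c ≤ g`), `aIIb c` (`2c > g`). -/
noncomputable def aMin (g q : ℕ) : ℚ :=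
  if g - q ≤ 10 then aI (g - q) else if 2 * (g - q) ≤ g then aIIa (g - q) else aIIb (g - q)

/-- `aMin g q · 2^q ≤ T⁺(g,q)` for `g ≥ 101`, `3 ≤ q ≤ g − 3` (the three regimes of §21.23). -/
theorem Tplus_ge_aMin {g q : ℕ} (hg : 101 ≤ g) (hq : 3 ≤ q) (hqg : q + 3 ≤ g) : aMin g q * 2 ^ q ≤ Tplus g q := by
  unfold aMin
  split_ifs with h1 h2
  · exact Tplus_ge_of_forall hq _ (fun m hm hmq => perPair4_margin hg hqg (by omega) hm hmq)
  · exact Tplus_ge_of_forall hq _ (fun m _ hmq => perPair4_margin_IIa hg hq (by omega) h2 hmq)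
  · exact Tplus_ge_of_forall hq _ (fun m _ hmq => perPair4_margin_IIb hg hq (by omega) (by omega) hmq)

/-! ## The numeric facts -/

/-- `aI c ≥ 1226293/2500000` for `3 ≤ c ≤ 10`. -/
theorem aI_ge {c : ℕ} (h3 : 3 ≤ c) (h10 : c ≤ 10) : (1226293 / 2500000 : ℚ) ≤ aI c := by
  interval_cases c <;> norm_num [aI]

/-- `(c + 108/5)·(c + 1) ≤ (799/1000)·(99/202)²·2^c` for `c ≥ 11`. -/
theorem aIIa_aux {c : ℕ} (hc : 11 ≤ c) : ((c : ℚ) + 108 / 5) * ((c : ℚ) + 1) ≤ 799 / 1000 * (99 / 202) ^ 2 * 2 ^ c := by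
  induction c, hc using Nat.le_induction with
  | base => norm_num
  | succ n hn ih =>
    have hnq : (11 : ℚ) ≤ n := by exact_mod_cast hn
    push_cast
    rw [show (2 : ℚ) ^ (n + 1) = 2 * 2 ^ n by ring]
    nlinarith [ih, hnq]

/-- `aIIa c ≥ 22` for `c ≥ 11`. -/
theorem aIIa_ge {c : ℕ} (hc : 11 ≤ c) : (22 : ℚ) ≤ aIIa c := by
  unfold aIIa
  have h := aIIa_aux hc
  have hc1 : (0 : ℚ) < (c : ℚ) + 1 := by positivity
  have : ((c : ℚ) + 108 / 5) ≤ 799 / 1000 * (99 / 202) ^ 2 * 2 ^ c / ((c : ℚ) + 1) := by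
    rw [le_div_iff₀ hc1]; linarith
  linarith

/-- `aIIb c ≥ 22` for `c ≥ 51`. -/
theorem aIIb_ge {c : ℕ} (hc : 51 ≤ c) : (22 : ℚ) ≤ aIIb c := by
  unfold aIIb
  have hcq : (51 : ℚ) ≤ c := by exact_mod_cast hc
  have h4 : (4 : ℚ) * (c : ℚ) ^ 4 ≤ 2 ^ c := by exact_mod_cast two_pow_ge_four_pow_four (by omega : 23 ≤ c)
  have hden : (0 : ℚ) < (c : ℚ) * (2 * c - 1) * (c + 1) := by
    have : (0 : ℚ) < 2 * c - 1 := by linarith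
    positivity
  have key : ((c : ℚ) + 108 / 5) * ((c : ℚ) * (2 * c - 1) * (c + 1)) ≤ 799 / 1000 * 3 * 2 ^ c := by
    have h1 : ((c : ℚ) + 108 / 5) * ((c : ℚ) * (2 * c - 1) * (c + 1)) ≤ 3 * (c : ℚ) ^ 4 := by nlinarith
    nlinarith
  have : ((c : ℚ) + 108 / 5) ≤ 799 / 1000 * 3 * 2 ^ c / ((c : ℚ) * (2 * c - 1) * (c + 1)) := by
    rw [le_div_iff₀ hden]; linarith
  linarith

/-- `51·q ≤ 2^q` for `q ≥ 9`. -/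
theorem two_pow_ge_51 {q : ℕ} (hq : 9 ≤ q) : 51 * q ≤ 2 ^ q := by
  induction q, hq using Nat.le_induction with
  | base => norm_num
  | succ n _ ih => rw [pow_succ]; omega

/-- `q ≤ 2^q`. -/
theorem le_two_pow' (q : ℕ) : q ≤ 2 ^ q := (Nat.lt_two_pow_self).le

/-- `10000·q ≤ 2^q` for `q ≥ 20`. -/
theorem two_pow_ge_10000 {q : ℕ} (hq : 20 ≤ q) : 10000 * q ≤ 2 ^ q := by
  induction q, hq using Nat.le_induction with
  | base => norm_num
  | succ n _ ih => rw [pow_succ]; omega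

/-- `(12/5)·2^s ≤ (3/10)·2^{n+s}` for `n ≥ 3`. -/
theorem twelve_fifth_pow_le {n s : ℕ} (hn : 3 ≤ n) : (12 / 5 : ℚ) * 2 ^ s ≤ 3 / 10 * 2 ^ (n + s) := by
  rw [pow_add]
  have h8 : (8 : ℚ) ≤ 2 ^ n := by
    calc (8 : ℚ) = 2 ^ 3 := by norm_num
      _ ≤ 2 ^ n := pow_le_pow_right₀ (by norm_num) hn
  have h2s : (0 : ℚ) ≤ 2 ^ s := by positivity
  nlinarith

/-- **A class term is nonnegative for `g ≥ 101`**: `0 ≤ w′(g,n,s)` when `n ≥ 3`, `1 ≤ s`, `n + s + 3 ≤ g`. -/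
theorem wprime_nonneg {g n s : ℕ} (hg : 101 ≤ g) (hn : 3 ≤ n) (hs : 1 ≤ s) (hsg : n + s + 3 ≤ g) :
    0 ≤ wprime g n s := by
  unfold wprime
  have hq3 : 3 ≤ n + s := by omega
  have hT := Tplus_ge_aMin hg hq3 (by omega)
  have h12 := twelve_fifth_pow_le (s := s) hn
  have hnq : (n : ℚ) ≤ ((n + s : ℕ) : ℚ) := by exact_mod_cast (by omega : n ≤ n + s)
  have hq0 : (0 : ℚ) ≤ 2 ^ (n + s) := by positivity
  unfold aMin at hT
  split_ifs at hT with h1 h2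
  · -- Regime I: `n + s ≥ g − 10 ≥ 91`
    have ha := aI_ge (by omega : 3 ≤ g - (n + s)) h1
    have hbig : 10000 * (n + s) ≤ 2 ^ (n + s) := two_pow_ge_10000 (by omega)
    have hbigq : (10000 : ℚ) * ((n + s : ℕ) : ℚ) ≤ 2 ^ (n + s) := by exact_mod_cast hbig
    have := mul_le_mul_of_nonneg_right ha hq0
    nlinarith
  · have ha := aIIa_ge (by omega : 11 ≤ g - (n + s))
    have hle : (n + s : ℕ) ≤ 2 ^ (n + s) := le_two_pow' _
    have hleq : ((n + s : ℕ) : ℚ) ≤ 2 ^ (n + s) := by exact_mod_cast hle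
    have := mul_le_mul_of_nonneg_right ha hq0
    nlinarith
  · have ha := aIIb_ge (by omega : 51 ≤ g - (n + s))
    have hle : (n + s : ℕ) ≤ 2 ^ (n + s) := le_two_pow' _
    have hleq : ((n + s : ℕ) : ℚ) ≤ 2 ^ (n + s) := by exact_mod_cast hle
    have := mul_le_mul_of_nonneg_right ha hq0
    nlinarith

/-- **`T⁺(g,p) ≥ 0`** for `g ≥ 101`, `3 ≤ p ≤ g − 3`. -/
theorem Tplus_nonneg {g p : ℕ} (hg : 101 ≤ g) (hp : 3 ≤ p) (hpg : p + 3 ≤ g) : 0 ≤ Tplus g p := by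
  have hT := Tplus_ge_aMin hg hp hpg
  have hq0 : (0 : ℚ) ≤ 2 ^ p := by positivity
  unfold aMin at hT
  split_ifs at hT with h1 h2
  · have ha := aI_ge (by omega : 3 ≤ g - p) h1
    nlinarith
  · have ha := aIIa_ge (by omega : 11 ≤ g - p)
    nlinarith
  · have ha := aIIb_ge (by omega : 51 ≤ g - p)
    nlinarith

/-- **The larger class absorbs the pair charge** for `g ≥ 101`: `(12/5)·2^{n+e} ≤ w′(g,n,s₁)` when `s₁ ≥ c₁ + e`
(`c₁ = g − n − s₁ ≥ 3`), `n ≥ 3`, `e ≤ 1`. -/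
theorem wprime_ge_charge {g n e s₁ : ℕ} (hg : 101 ≤ g) (hn : 3 ≤ n) (he : e ≤ 1) (hs3 : n + s₁ + 3 ≤ g)
    (hsc : g - n - s₁ + e ≤ s₁) : (12 / 5 : ℚ) * 2 ^ (n + e) ≤ wprime g n s₁ := by
  unfold wprime
  have hq3 : 3 ≤ n + s₁ := by omega
  have hT := Tplus_ge_aMin hg hq3 (by omega)
  have h12 := twelve_fifth_pow_le (s := s₁) hn
  have hq0 : (0 : ℚ) ≤ 2 ^ (n + s₁) := by positivity
  -- the charge: `2^{n+e}·2^{c₁} ≤ 2^{n+s₁}` with `c₁ = g − n − s₁ ≥ 3`, so `(12/5)·2^{n+e} ≤ (3/10)·2^{n+s₁}`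
  have hcharge : (12 / 5 : ℚ) * 2 ^ (n + e) ≤ 3 / 10 * 2 ^ (n + s₁) := by
    have h1 : (2 : ℚ) ^ (n + e + 3) ≤ 2 ^ (n + s₁) := pow_le_pow_right₀ (by norm_num) (by omega)
    rw [pow_add _ (n + e) 3] at h1
    nlinarith
  unfold aMin at hT
  split_ifs at hT with h1 h2
  · -- Regime I (`c₁ ≤ 10`, so `n + s₁ ≥ 91`)
    have ha := aI_ge (by omega : 3 ≤ g - (n + s₁)) h1
    have := mul_le_mul_of_nonneg_right ha hq0
    rcases Nat.lt_or_ge n 10 with hn10 | hn10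
    · -- `n ≤ 9`: `s₁ ≥ 46`, the charge is at most `(12/5)·2^10` and `2^{n+s₁} ≥ 2^49`
      have hs46 : 46 ≤ s₁ := by omega
      have hch : (12 / 5 : ℚ) * 2 ^ (n + e) ≤ 12 / 5 * 2 ^ 10 := by
        have : (2 : ℚ) ^ (n + e) ≤ 2 ^ 10 := pow_le_pow_right₀ (by norm_num) (by omega)
        linarith
      have h49 : (2 : ℚ) ^ 49 ≤ 2 ^ (n + s₁) := pow_le_pow_right₀ (by norm_num) (by omega)
      have hnq : (n : ℚ) ≤ 9 := by exact_mod_cast (by omega : n ≤ 9)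
      nlinarith
    · -- `n ≥ 10`: `(12/5)·2^{s₁} ≤ (12/5)·2^{n+s₁}/1024` and `(48/5)·n ≤ 2^{n+s₁}/1000`
      have h1024 : (1024 : ℚ) * 2 ^ s₁ ≤ 2 ^ (n + s₁) := by
        rw [pow_add]
        have : (1024 : ℚ) ≤ 2 ^ n := by
          calc (1024 : ℚ) = 2 ^ 10 := by norm_num
            _ ≤ 2 ^ n := pow_le_pow_right₀ (by norm_num) hn10
        have : (0 : ℚ) ≤ 2 ^ s₁ := by positivity
        nlinarith
      have hbig : 10000 * (n + s₁) ≤ 2 ^ (n + s₁) := two_pow_ge_10000 (by omega)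
      have hbigq : (10000 : ℚ) * ((n + s₁ : ℕ) : ℚ) ≤ 2 ^ (n + s₁) := by exact_mod_cast hbig
      have hnq : (n : ℚ) ≤ ((n + s₁ : ℕ) : ℚ) := by exact_mod_cast (by omega : n ≤ n + s₁)
      nlinarith
  · have ha := aIIa_ge (by omega : 11 ≤ g - (n + s₁))
    have hle : (n + s₁ : ℕ) ≤ 2 ^ (n + s₁) := le_two_pow' _
    have hleq : ((n + s₁ : ℕ) : ℚ) ≤ 2 ^ (n + s₁) := by exact_mod_cast hle
    have hnq : (n : ℚ) ≤ ((n + s₁ : ℕ) : ℚ) := by exact_mod_cast (by omega : n ≤ n + s₁)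
    have := mul_le_mul_of_nonneg_right ha hq0
    nlinarith
  · have ha := aIIb_ge (by omega : 51 ≤ g - (n + s₁))
    have hle : (n + s₁ : ℕ) ≤ 2 ^ (n + s₁) := le_two_pow' _
    have hleq : ((n + s₁ : ℕ) : ℚ) ≤ 2 ^ (n + s₁) := by exact_mod_cast hle
    have hnq : (n : ℚ) ≤ ((n + s₁ : ℕ) : ℚ) := by exact_mod_cast (by omega : n ≤ n + s₁)
    have := mul_le_mul_of_nonneg_right ha hq0
    nlinarith

/-- **`TWTail` holds** (§21.18.7 TW-∞ with the exact margins of §21.23). -/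
theorem twTail_holds : TWTail := by
  intro g n e hg hn he hng
  refine ⟨fun s hs1 hs3 => wprime_nonneg hg hn (by omega) (by omega), Tplus_nonneg hg (by omega) (by omega),
    fun s₁ s₂ h1 h2 h3 h4 hsum hle => wprime_ge_charge hg hn he (by omega) (by omega)⟩

end PercRepro.SixFour
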